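import Summits.AnomalousDissipation.AnomalousDissipation.Theorems.MirrorStatisticsLoudTG.Negative.LoadBearing
import Summits.AnomalousDissipation.AnomalousDissipation.Theorems.MirrorEnsembleMirrorStatisticsLoudTGStubTubeLawTransferKTools
import HarnessLib

/-!
# Stub `stub_tubeLawTransferK` (T3) of line `regimes`, crux `MirrorEnsemble.MirrorStatisticsLoudTG`
# (stmt-AnomalousDissipation-17693): transfer of the tube inequality to finite-enstrophy mirror classes

THE STATISTICAL KELVIN TUBE LAW LIVES ON `L²` CLASSES. The deterministic tube inequality of T2b,
`|∫ ⟪∇g(x) v(x), v(x)⟫ dx| ≤ (C/δ) ∫_{N_δ} ∑ⱼ ‖∂ⱼv‖²` for SMOOTH solenoidal mean-zero fields `v` on `T³` that are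
exactly symmetric under the mirror group `K` of the Taylor–Green cell (`v_j(R_i x) = ∓ v_j(x)`,
`R_i x = update x i (−x i)`), is transferred to the objects stationary statistical solutions are carried by:
every `L²` class `v` in the a.e. mirror class `Fix K ⊆ H` of finite (spectral) enstrophy obeys
`|∫ (v ⊗ v) : ∇g| ≤ (C/δ) Λv` for every majorant `Λv` of the local enstrophy `∫_{N_δ} ∑ⱼ ‖wⱼ‖²` of its
square-integrable weak partial derivatives `wⱼ` (here `N_δ` is the skeleton tube of the cell and `g` any smooth
field, e.g. the tube current of T1).

Proof (Galerkin truncation; all ingredients in the landed tools file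
`Theorems/MirrorEnsembleMirrorStatisticsLoudTGStubTubeLawTransferKTools.lean`):
* finite enstrophy `4π² ∑ₖ |k|² ‖v̂(k)‖² < ∞` gives `L²` weak partial derivatives `wⱼ` (Riesz–Fischer on the
  coefficients `2πi kⱼ v̂(k)`; Evans 2010, §5.8 Thm. 8), so the majorant hypothesis is not vacuous;
* the Fourier truncations `P_N v` (Robinson–Rodrigo–Sadowski 2016, §4.1) are smooth, divergence free (the
  coefficients of `v ∈ H` are transversal), mean-zero, and EXACTLY `K`-symmetric (the coefficients of an a.e.
  `K`-symmetric field are mirror-related, Brachet et al. 1983, §2), and `∂ⱼ P_N v = P_N wⱼ` (truncation commutes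
  with weak derivatives); hence the smooth tube inequality applies to every `P_N v`;
* `N → ∞`: `P_N v → v` and `P_N wⱼ → wⱼ` in `L²` (RRS 2016, Lemma 4.1), the inertial pairing is norm-continuous on
  `L²` (FMRT 2001, Ch. IV (1.9)) and the local `L²` mass on `N_δ` is continuous, so the inequality passes to the
  limit (in `[0, ∞]`), and `∫⁻_{N_δ} ∑ⱼ ‖wⱼ‖ₑ² ≤ Λv` concludes.

References: C. Foias, O. Manley, R. Rosa, R. Temam, *Navier–Stokes Equations and Turbulence* (CUP 2001), Ch. IV §1
[FMRTTurbulence2001]; L. C. Evans, *Partial Differential Equations*, 2nd ed. (AMS 2010), §5.2.1, §5.8 Thm. 8,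
App. C.4 [Evans2010]; J. C. Robinson, J. L. Rodrigo, W. Sadowski, *The Three-Dimensional Navier–Stokes Equations*
(CUP 2016), §4.1, Lemma 4.1 [RobinsonRodrigoSadowski2016]; M. E. Brachet et al., J. Fluid Mech. 130 (1983) 411–452,
§2 [doi:10.1017/s0022112083001159].
-/

-- every `Summit.AnomalousDissipation.AnomalousDissipation.…` name repeats the summit = problem segment (tree layout)
set_option linter.dupNamespace false

noncomputable section

namespace Summit.AnomalousDissipation.AnomalousDissipation.Theorems.MirrorEnsembleMirrorStatisticsLoudTG

open MeasureTheory Filter Topology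
open scoped ENNReal InnerProductSpace NNReal
open Literature.Analysis.FunctionSpaces Literature.Analysis.FluidPDE
open Summit.AnomalousDissipation.AnomalousDissipation.Theorems.TaylorGreenLoudGalerkinStates.Negative
  (tgForce isSmooth_tgForce isDivFree_tgForce hasZeroMean_tgForce integral_norm_sq_tgForce)
open Summit.AnomalousDissipation.AnomalousDissipation.Theorems.MirrorStatisticsLoudTG.Negative
  (mirrorClass memLp_tgForce measurePreserving_reflect)

/-- Local notation: the energy space `H` of `T³`. -/
local notation "H3" => Torus.energySpace (Fin 3)

/-- **T3 `stub_tubeLawTransferK` — transfer of the tube inequality to finite-enstrophy mirror classes.** If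
`|∫ ⟪∇g v, v⟫| ≤ (C/δ) ∫_{N_δ} ∑ⱼ ‖∂ⱼv‖²` holds for all smooth solenoidal mean-zero exactly `K`-symmetric fields
`v` on `T³` (`C ≥ 0`, `δ > 0`, `g` smooth), then for every `v ∈ Fix K ⊆ H` of finite enstrophy and every majorant
`Λv` of the local enstrophy `∫⁻_{N_δ} ∑ⱼ ‖wⱼ‖ₑ²` of its `L²` weak partial derivatives `wⱼ`,
`ofReal |∫ (v ⊗ v) : ∇g| ≤ ofReal (C/δ) · Λv`. Proof: apply the hypothesis to the Fourier truncations `P_N v`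
(smooth, divergence free, mean-zero, exactly `K`-symmetric, `∂ⱼ P_N v = P_N wⱼ` for the `L²` weak gradient `wⱼ`
that finite enstrophy provides) and let `N → ∞` (`P_N v → v`, `P_N wⱼ → wⱼ` in `L²`; continuity of the inertial
pairing and of the local `L²` mass). [folklore] -/
theorem stub_tubeLawTransferK :
    ∀ (C δ : ℝ) (g : UnitAddTorus (Fin 3) → EuclideanSpace ℝ (Fin 3)), 0 ≤ C → 0 < δ → Torus.IsSmooth g →
      (∀ v : UnitAddTorus (Fin 3) → EuclideanSpace ℝ (Fin 3), Torus.IsSmooth v → Torus.IsDivFree v →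
        Torus.HasZeroMean v →
        (∀ (i j : Fin 3) (x : UnitAddTorus (Fin 3)), v (Function.update x i (-x i)) j = if j = i then -(v x j) else v x j) →
        |∫ x, ⟪Torus.fderiv g x (v x), v x⟫_ℝ| ≤
          C / δ * ∫ x in {x : UnitAddTorus (Fin 3) | ‖x 2‖ ≤ δ ∧ (‖x 0‖ ≤ 2 * δ ∨
              ‖x 0 - ((2⁻¹ : ℝ) : UnitAddCircle)‖ ≤ 2 * δ ∨ ‖x 1‖ ≤ 2 * δ ∨ ‖x 1 - ((2⁻¹ : ℝ) : UnitAddCircle)‖ ≤ 2 * δ)},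
            ∑ j, ‖Torus.partialDeriv j v x‖ ^ 2) →
      ∀ v : H3, v ∈ mirrorClass →
        Torus.eGradNormSq ((v : Lp (EuclideanSpace ℝ (Fin 3)) 2 (volume : Measure (UnitAddTorus (Fin 3)))) :
          UnitAddTorus (Fin 3) → EuclideanSpace ℝ (Fin 3)) ≠ ⊤ →
        ∀ Λv : ℝ≥0∞,
          (∀ w : Fin 3 → UnitAddTorus (Fin 3) → EuclideanSpace ℝ (Fin 3),
            (∀ j, Torus.HasWeakPartialDeriv j
              ((v : Lp (EuclideanSpace ℝ (Fin 3)) 2 (volume : Measure (UnitAddTorus (Fin 3)))) :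
                UnitAddTorus (Fin 3) → EuclideanSpace ℝ (Fin 3)) (w j)) →
            (∀ j, MemLp (w j) 2 volume) →
            ∫⁻ x in {x : UnitAddTorus (Fin 3) | ‖x 2‖ ≤ δ ∧ (‖x 0‖ ≤ 2 * δ ∨
                ‖x 0 - ((2⁻¹ : ℝ) : UnitAddCircle)‖ ≤ 2 * δ ∨ ‖x 1‖ ≤ 2 * δ ∨ ‖x 1 - ((2⁻¹ : ℝ) : UnitAddCircle)‖ ≤ 2 * δ)},
              ∑ j, ‖w j x‖ₑ ^ 2 ≤ Λv) →
          ENNReal.ofReal |Torus.inertialPairing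
              (v : Lp (EuclideanSpace ℝ (Fin 3)) 2 (volume : Measure (UnitAddTorus (Fin 3)))) g| ≤
            ENNReal.ofReal (C / δ) * Λv := by
  intro C δ g hC hδ hg htube v hv hG Λv hΛ
  -- the skeleton tube and a representative of the class
  set S : Set (UnitAddTorus (Fin 3)) := {x : UnitAddTorus (Fin 3) | ‖x 2‖ ≤ δ ∧ (‖x 0‖ ≤ 2 * δ ∨
    ‖x 0 - ((2⁻¹ : ℝ) : UnitAddCircle)‖ ≤ 2 * δ ∨ ‖x 1‖ ≤ 2 * δ ∨ ‖x 1 - ((2⁻¹ : ℝ) : UnitAddCircle)‖ ≤ 2 * δ)}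
    with hS
  set u : UnitAddTorus (Fin 3) → EuclideanSpace ℝ (Fin 3) :=
    ((v : Lp (EuclideanSpace ℝ (Fin 3)) 2 (volume : Measure (UnitAddTorus (Fin 3)))) :
      UnitAddTorus (Fin 3) → EuclideanSpace ℝ (Fin 3)) with hu
  have hu2 : MemLp u 2 volume := Lp.memLp _
  have hui : Integrable u volume := hu2.integrable one_le_two
  -- Step A: a square-integrable weak gradient `w` (finite enstrophy; the majorant hypothesis is not vacuous)
  obtain ⟨w, hw, hw2⟩ := exists_hasWeakPartialDeriv_of_eGradNormSq_ne_top u hu2 hG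
  -- Step B: the truncations `P_N u` are admissible exactly `K`-symmetric test fields with `∂ⱼ P_N u = P_N wⱼ`
  have hPd : ∀ N : ℕ, Torus.IsDivFree (Torus.fourierTruncate N u) := fun N =>
    Torus.isDivFree_fourierTruncate hu2 (Torus.isWeaklyDivFree_of_mem_energySpace v.2) N
  have hP0 : ∀ N : ℕ, Torus.HasZeroMean (Torus.fourierTruncate N u) := fun N =>
    Torus.hasZeroMean_fourierTruncate_of_mem v.2 N
  have hPK : ∀ (N : ℕ) (i j : Fin 3) (x : UnitAddTorus (Fin 3)),
      Torus.fourierTruncate N u (Function.update x i (-x i)) j =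
        if j = i then -(Torus.fourierTruncate N u x j) else Torus.fourierTruncate N u x j :=
    fourierTruncate_mirror_of_mem_mirrorClass v hv
  have hD : ∀ (N : ℕ) (j : Fin 3),
      Torus.partialDeriv j (Torus.fourierTruncate N u) = Torus.fourierTruncate N (w j) := fun N j =>
    partialDeriv_fourierTruncate_of_hasWeakPartialDeriv j u (w j) hui ((hw2 j).integrable one_le_two) (hw j) N
  -- the smooth tube inequality on the truncations, in `[0, ∞]`
  have hineq : ∀ N : ℕ, ENNReal.ofReal |∫ x, ⟪Torus.fderiv g x (Torus.fourierTruncate N u x),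
      Torus.fourierTruncate N u x⟫_ℝ| ≤
      ENNReal.ofReal (C / δ) * ∫⁻ x in S, ∑ j, ‖Torus.fourierTruncate N (w j) x‖ₑ ^ 2 := by
    intro N
    have h := htube (Torus.fourierTruncate N u) (Torus.isSmooth_fourierTruncate N u) (hPd N) (hP0 N) (hPK N)
    simp_rw [hD N] at h
    calc ENNReal.ofReal |∫ x, ⟪Torus.fderiv g x (Torus.fourierTruncate N u x), Torus.fourierTruncate N u x⟫_ℝ|
        ≤ ENNReal.ofReal (C / δ * ∫ x in S, ∑ j, ‖Torus.fourierTruncate N (w j) x‖ ^ 2) :=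
          ENNReal.ofReal_le_ofReal h
      _ = ENNReal.ofReal (C / δ) * ENNReal.ofReal (∫ x in S, ∑ j, ‖Torus.fourierTruncate N (w j) x‖ ^ 2) :=
          ENNReal.ofReal_mul (div_nonneg hC hδ.le)
      _ = ENNReal.ofReal (C / δ) * ∫⁻ x in S, ∑ j, ‖Torus.fourierTruncate N (w j) x‖ₑ ^ 2 := by
          rw [ofReal_setIntegral_sum_norm_sq (fun j => Torus.continuous_fourierTruncate N (w j)) S]
  -- Step C: `N → ∞` on both sides
  have hL : Tendsto (fun N : ℕ => ENNReal.ofReal |∫ x, ⟪Torus.fderiv g x (Torus.fourierTruncate N u x),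
      Torus.fourierTruncate N u x⟫_ℝ|) atTop
      (𝓝 (ENNReal.ofReal |Torus.inertialPairing
        (v : Lp (EuclideanSpace ℝ (Fin 3)) 2 (volume : Measure (UnitAddTorus (Fin 3)))) g|)) :=
    ((ENNReal.continuous_ofReal.comp continuous_abs).tendsto _).comp
      (tendsto_inertialPairing_fourierTruncate _ hg)
  have hR : Tendsto (fun N : ℕ => ENNReal.ofReal (C / δ) *
      ∫⁻ x in S, ∑ j, ‖Torus.fourierTruncate N (w j) x‖ₑ ^ 2) atTop
      (𝓝 (ENNReal.ofReal (C / δ) * ∫⁻ x in S, ∑ j, ‖w j x‖ₑ ^ 2)) :=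
    ENNReal.Tendsto.const_mul (tendsto_setLIntegral_sum_enorm_sq_fourierTruncate hw2 S)
      (Or.inr ENNReal.ofReal_ne_top)
  have hle : ENNReal.ofReal |Torus.inertialPairing
      (v : Lp (EuclideanSpace ℝ (Fin 3)) 2 (volume : Measure (UnitAddTorus (Fin 3)))) g| ≤
      ENNReal.ofReal (C / δ) * ∫⁻ x in S, ∑ j, ‖w j x‖ₑ ^ 2 :=
    le_of_tendsto_of_tendsto' hL hR hineq
  -- Step D: any majorant of the local enstrophy of this weak gradient
  exact hle.trans (mul_le_mul' le_rfl (hΛ w hw hw2))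

end Summit.AnomalousDissipation.AnomalousDissipation.Theorems.MirrorEnsembleMirrorStatisticsLoudTG

end
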